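import Mathlib
import HarnessLib
import Summits.Ventures.LatticeQCDFlow.Exactness.SU2FTHMCGaugeCovariance
import Summits.Ventures.LatticeQCDFlow.Exactness.SU2StapleFieldCovariance
import Summits.Ventures.LatticeQCDFlow.Exactness.SU2WilsonFlowLOSubstep

/-!
# The Wilson force routine is `Ad`-covariant; `SU(2)` HMC with it (identity member) commutes with every gauge transformation — no hypothesis on the force left

HONEST FRAMING: exact (Metropolis-corrected) sampling algorithms for lattice gauge theory;
figures of merit are autocorrelation/cost numbers at stated couplings and volumes; no
continuum-physics claim.

Venture `LatticeQCDFlow` (cell pub-lqcd), topic `Exactness`; FANOUT row 14 (`eng-flowhmc`, engine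
`latflow.fthmc` on the `SU(2)` rung; its identity member is plain gauge-link HMC).  NEW WORK of the
cell; nothing is cited as a fact; no number.  `SU2FTHMCGaugeCovariance.su2_fthmc_conjKernel_gaugeTransform`
leaves ONE hypothesis on the otherwise arbitrary measurable force routine `g`: covariance
`g (V^h)_ℓ = Ad_(h_x) (g V)_ℓ`.  This file discharges it for the force routine of the Wilson
action — in quaternion coordinates, for the drift `U_ℓ ← exp(c P_ℓ) U_ℓ`, the force at the link
`ℓ = (x, μ)` is (any real multiple `κ` of) the pure part of the FORCE MATRIX
`M_ℓ(V) = U_ℓ · R_ℓ(V)`, `R_ℓ = (quatVec J_ℓ(V))ᴴ` the staple sum (`J_ℓ` = the conjugate staple sum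
of `SU2WilsonFlowLOSubstep`, so that `Σ_{p ∋ ℓ} Re tr U_p = Re tr (U_ℓ R_ℓ)` and
`d/dt Re tr (e^{tX} U_ℓ R_ℓ) = Re tr (X M_ℓ)` is the pairing of `X ∈ su(2)` with the pure part of `M_ℓ`):

* quaternion bookkeeping: `quatVec_real` (`quatVec (a,0,0,0) = a·1`), `eq_real_add_pure` (a
  quaternion is its scalar part plus its pure part), `vecQuat_one_succ`, **`vecQuat_conj_succ`**
  (the pure part of `G M Gᴴ` is the conjugate of the pure part of `M`, `G ∈ SU(2)`);
* **`su2WilsonForceMatrix_gaugeTransform`** — `M_ℓ(V^h) = h_x · M_ℓ(V) · h_xᴴ` (the link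
  transforms as `h_x U h_y⁻¹`, the conjugate staple sum as `h_x J h_yᴴ` by GEN-9's
  `quatVec_stapleJ_gaugeTransform`, and `h_y⁻¹ h_y = 1`);
* **`su2WilsonForce_gaugeTransform`** — THE WILSON FORCE ROUTINE IS COVARIANT:
  `g_κ (V^h) = R_h (g_κ V)` with `g_κ V (ℓ, i) = κ · vecQuat (M_ℓ(V)) (i+1)` and `R_h` the adjoint
  momentum rotation of `SU2MomentumRotation` — exactly the hypothesis `hgc` of
  `su2_fthmc_conjKernel_gaugeTransform`, for every `κ : ℝ`; `measurable_su2WilsonForce`;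
* **`su2_hmc_wilsonForce_conjKernel_gaugeTransform`** — HMC on the `SU(2)` rung exactly as the
  engine runs its identity member (refresh `N(0,1)` momenta, leapfrog^n with the quaternion
  exponential drift and the Wilson force routine `g_κ`, flip, Metropolis on `S + Σ p²/2`, forget)
  commutes with every gauge transformation, for EVERY gauge-invariant measurable action `S`,
  every `c`, `κ`, `n` — no hypothesis on the force is left (`gauge_hmc_conjKernel_eq_self`, the
  member-free form of `FTHMCKernelCovariance.gauge_fthmc_conjKernel_eq_self`);
  `su2_fthmc_wilsonForce_conjKernel_gaugeTransform` — the FT-HMC kernel of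
  `su2_fthmc_conjKernel_gaugeTransform` driven by the routine `g_κ` (any equivariant member,
  invariant booked density): the force hypothesis discharged.

NOT CLAIMED: that `g_κ` with a particular `κ` IS the engine's autodiff output for `β S_W` (the
normalisation of the su(2) basis against the quaternion coordinates is not typed here; exactness
and covariance hold for every `κ`); the autodiff force of a non-identity member; `SU(N ≥ 3)`; any number.
-/

noncomputable section

namespace Summit.Ventures.LatticeQCDFlow.Exactness

open WithLp Set MeasureTheory
open ProbabilityTheory ProbabilityTheory.Kernel
open Literature.MathematicalPhysics.QuantumFieldTheory Literature.Barriers.QuantumFields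
open scoped ENNReal Matrix

/-! ## Quaternion bookkeeping: scalar and pure parts under conjugation -/

section Quaternion

/-- The scalar quaternion: `quatVec (a, 0, 0, 0) = a · 1`. -/
theorem quatVec_real (a : ℝ) :
    quatVec (toLp 2 ![a, 0, 0, 0]) = ((a : ℂ) • (1 : Matrix (Fin 2) (Fin 2) ℂ)) := by
  ext i j
  fin_cases i <;> fin_cases j <;> simp

/-- A quaternion is its scalar part plus its pure part. -/
theorem eq_real_add_pure {M : Matrix (Fin 2) (Fin 2) ℂ} (hM : IsQuat M) :
    M = ((vecQuat M 0 : ℝ) : ℂ) • (1 : Matrix (Fin 2) (Fin 2) ℂ) + quatVec (toLp 2 ![0, vecQuat M 1, vecQuat M 2, vecQuat M 3]) := by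
  conv_lhs => rw [← quatVec_vecQuat hM]
  rw [← quatVec_real, ← quatVec_add]
  congr 1
  ext i
  fin_cases i <;> simp

/-- The identity has no pure part. -/
theorem vecQuat_one_succ (i : Fin 3) : vecQuat (1 : Matrix (Fin 2) (Fin 2) ℂ) i.succ = 0 := by
  fin_cases i <;> simp

/-- **The pure part of a conjugate is the conjugate of the pure part**: for `G ∈ SU(2)` and a
quaternion `M`, `vecQuat (G M Gᴴ) (i+1) = vecQuat (G · quatVec (0, vecQuat M 1, vecQuat M 2, vecQuat M 3) · Gᴴ) (i+1)`. -/
theorem vecQuat_conj_succ (G : Matrix.specialUnitaryGroup (Fin 2) ℂ) {M : Matrix (Fin 2) (Fin 2) ℂ} (hM : IsQuat M) (i : Fin 3) :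
    vecQuat ((G : Matrix (Fin 2) (Fin 2) ℂ) * M * (G : Matrix (Fin 2) (Fin 2) ℂ)ᴴ) i.succ =
      vecQuat ((G : Matrix (Fin 2) (Fin 2) ℂ) * quatVec (toLp 2 ![0, vecQuat M 1, vecQuat M 2, vecQuat M 3]) * (G : Matrix (Fin 2) (Fin 2) ℂ)ᴴ) i.succ := by
  conv_lhs => rw [eq_real_add_pure hM]
  rw [Matrix.mul_add, Matrix.add_mul, Matrix.mul_smul, Matrix.smul_mul, Matrix.mul_one,
    WilsonFlow.mul_conjTranspose_self_SU, vecQuat_add, PiLp.add_apply, vecQuat_smul, PiLp.smul_apply,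
    vecQuat_one_succ, smul_zero, zero_add]

end Quaternion

/-! ## The Wilson force matrix transforms by conjugation at the base point -/

section Force

variable {d L : ℕ}

/-- **`M_ℓ(V^h) = h_x · M_ℓ(V) · h_xᴴ`** for the Wilson force matrix `M_ℓ(V) = U_ℓ · (quatVec J_ℓ(V))ᴴ`
(`J_ℓ` the conjugate staple sum through `ℓ = (x, μ)`). -/
theorem su2WilsonForceMatrix_gaugeTransform (h : Site d L → Matrix.specialUnitaryGroup (Fin 2) ℂ) (V : GaugeConfig d L (Matrix.specialUnitaryGroup (Fin 2) ℂ)) (e : Edge d L) :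
    ((((gaugeTransform h V) e : Matrix.specialUnitaryGroup (Fin 2) ℂ) : Matrix (Fin 2) (Fin 2) ℂ) * (quatVec (∑ ν ∈ Finset.univ.erase e.2,
            (vecQuat ((((gaugeTransform h V) (Site.shift e.1 e.2, ν) * ((gaugeTransform h V) (Site.shift e.1 ν, e.2))⁻¹ * ((gaugeTransform h V) (e.1, ν))⁻¹)⁻¹ : (Matrix.specialUnitaryGroup (Fin 2) ℂ)) : Matrix (Fin 2) (Fin 2) ℂ) +
              vecQuat (((((gaugeTransform h V) (Site.shift (e.1 - Pi.single ν 1) e.2, ν))⁻¹ * ((gaugeTransform h V) (e.1 - Pi.single ν 1, e.2))⁻¹ *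
                (gaugeTransform h V) (e.1 - Pi.single ν 1, ν))⁻¹ : (Matrix.specialUnitaryGroup (Fin 2) ℂ)) : Matrix (Fin 2) (Fin 2) ℂ))))ᴴ) =
      ((h e.1 : Matrix.specialUnitaryGroup (Fin 2) ℂ) : Matrix (Fin 2) (Fin 2) ℂ) * (((V e : Matrix.specialUnitaryGroup (Fin 2) ℂ) : Matrix (Fin 2) (Fin 2) ℂ) * (quatVec (∑ ν ∈ Finset.univ.erase e.2,
            (vecQuat (((V (Site.shift e.1 e.2, ν) * (V (Site.shift e.1 ν, e.2))⁻¹ * (V (e.1, ν))⁻¹)⁻¹ : (Matrix.specialUnitaryGroup (Fin 2) ℂ)) : Matrix (Fin 2) (Fin 2) ℂ) +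
              vecQuat ((((V (Site.shift (e.1 - Pi.single ν 1) e.2, ν))⁻¹ * (V (e.1 - Pi.single ν 1, e.2))⁻¹ *
                V (e.1 - Pi.single ν 1, ν))⁻¹ : (Matrix.specialUnitaryGroup (Fin 2) ℂ)) : Matrix (Fin 2) (Fin 2) ℂ))))ᴴ) * (((h e.1 : Matrix.specialUnitaryGroup (Fin 2) ℂ) : Matrix (Fin 2) (Fin 2) ℂ))ᴴ := by
  rw [quatVec_stapleJ_gaugeTransform h V e]
  simp only [gaugeTransform, WilsonFlow.coe_mul_SU, WilsonFlow.coe_inv_SU, Matrix.conjTranspose_mul,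
    Matrix.conjTranspose_conjTranspose, Matrix.mul_assoc]
  rw [← Matrix.mul_assoc ((((h (e.1.shift e.2) : Matrix.specialUnitaryGroup (Fin 2) ℂ) : Matrix (Fin 2) (Fin 2) ℂ))ᴴ) (((h (e.1.shift e.2) : Matrix.specialUnitaryGroup (Fin 2) ℂ) : Matrix (Fin 2) (Fin 2) ℂ)),
    WilsonFlow.conjTranspose_mul_self_SU, Matrix.one_mul]

/-- **The Wilson force routine is covariant**: `g_κ (V^h) = R_h (g_κ V)` — the hypothesis `hgc` of
`su2_fthmc_conjKernel_gaugeTransform`, for every real constant `κ`. -/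
theorem su2WilsonForce_gaugeTransform (κ : ℝ) (h : Site d L → Matrix.specialUnitaryGroup (Fin 2) ℂ) (V : GaugeConfig d L (Matrix.specialUnitaryGroup (Fin 2) ℂ)) :
    (fun q : Edge d L × Fin 3 => κ * vecQuat ((((gaugeTransform h V) q.1 : Matrix.specialUnitaryGroup (Fin 2) ℂ) : Matrix (Fin 2) (Fin 2) ℂ) * (quatVec (∑ ν ∈ Finset.univ.erase q.1.2,
            (vecQuat ((((gaugeTransform h V) (Site.shift q.1.1 q.1.2, ν) * ((gaugeTransform h V) (Site.shift q.1.1 ν, q.1.2))⁻¹ * ((gaugeTransform h V) (q.1.1, ν))⁻¹)⁻¹ : (Matrix.specialUnitaryGroup (Fin 2) ℂ)) : Matrix (Fin 2) (Fin 2) ℂ) +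
              vecQuat (((((gaugeTransform h V) (Site.shift (q.1.1 - Pi.single ν 1) q.1.2, ν))⁻¹ * ((gaugeTransform h V) (q.1.1 - Pi.single ν 1, q.1.2))⁻¹ *
                (gaugeTransform h V) (q.1.1 - Pi.single ν 1, ν))⁻¹ : (Matrix.specialUnitaryGroup (Fin 2) ℂ)) : Matrix (Fin 2) (Fin 2) ℂ))))ᴴ) q.2.succ) =
      (fun q : Edge d L × Fin 3 => (vecQuat (((h q.1.1 : Matrix.specialUnitaryGroup (Fin 2) ℂ) : Matrix (Fin 2) (Fin 2) ℂ) * quatVec (toLp 2 ![0, (fun q : Edge d L × Fin 3 => κ * vecQuat (((V q.1 : Matrix.specialUnitaryGroup (Fin 2) ℂ) : Matrix (Fin 2) (Fin 2) ℂ) * (quatVec (∑ ν ∈ Finset.univ.erase q.1.2,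
            (vecQuat (((V (Site.shift q.1.1 q.1.2, ν) * (V (Site.shift q.1.1 ν, q.1.2))⁻¹ * (V (q.1.1, ν))⁻¹)⁻¹ : (Matrix.specialUnitaryGroup (Fin 2) ℂ)) : Matrix (Fin 2) (Fin 2) ℂ) +
              vecQuat ((((V (Site.shift (q.1.1 - Pi.single ν 1) q.1.2, ν))⁻¹ * (V (q.1.1 - Pi.single ν 1, q.1.2))⁻¹ *
                V (q.1.1 - Pi.single ν 1, ν))⁻¹ : (Matrix.specialUnitaryGroup (Fin 2) ℂ)) : Matrix (Fin 2) (Fin 2) ℂ))))ᴴ) q.2.succ) (q.1, 0), (fun q : Edge d L × Fin 3 => κ * vecQuat (((V q.1 : Matrix.specialUnitaryGroup (Fin 2) ℂ) : Matrix (Fin 2) (Fin 2) ℂ) * (quatVec (∑ ν ∈ Finset.univ.erase q.1.2,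
            (vecQuat (((V (Site.shift q.1.1 q.1.2, ν) * (V (Site.shift q.1.1 ν, q.1.2))⁻¹ * (V (q.1.1, ν))⁻¹)⁻¹ : (Matrix.specialUnitaryGroup (Fin 2) ℂ)) : Matrix (Fin 2) (Fin 2) ℂ) +
              vecQuat ((((V (Site.shift (q.1.1 - Pi.single ν 1) q.1.2, ν))⁻¹ * (V (q.1.1 - Pi.single ν 1, q.1.2))⁻¹ *
                V (q.1.1 - Pi.single ν 1, ν))⁻¹ : (Matrix.specialUnitaryGroup (Fin 2) ℂ)) : Matrix (Fin 2) (Fin 2) ℂ))))ᴴ) q.2.succ) (q.1, 1), (fun q : Edge d L × Fin 3 => κ * vecQuat (((V q.1 : Matrix.specialUnitaryGroup (Fin 2) ℂ) : Matrix (Fin 2) (Fin 2) ℂ) * (quatVec (∑ ν ∈ Finset.univ.erase q.1.2,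
            (vecQuat (((V (Site.shift q.1.1 q.1.2, ν) * (V (Site.shift q.1.1 ν, q.1.2))⁻¹ * (V (q.1.1, ν))⁻¹)⁻¹ : (Matrix.specialUnitaryGroup (Fin 2) ℂ)) : Matrix (Fin 2) (Fin 2) ℂ) +
              vecQuat ((((V (Site.shift (q.1.1 - Pi.single ν 1) q.1.2, ν))⁻¹ * (V (q.1.1 - Pi.single ν 1, q.1.2))⁻¹ *
                V (q.1.1 - Pi.single ν 1, ν))⁻¹ : (Matrix.specialUnitaryGroup (Fin 2) ℂ)) : Matrix (Fin 2) (Fin 2) ℂ))))ᴴ) q.2.succ) (q.1, 2)]) * (((h q.1.1 : Matrix.specialUnitaryGroup (Fin 2) ℂ) : Matrix (Fin 2) (Fin 2) ℂ))ᴴ)) q.2.succ) := by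
  funext q
  obtain ⟨e, i⟩ := q
  have hq : IsQuat (((V e : Matrix.specialUnitaryGroup (Fin 2) ℂ) : Matrix (Fin 2) (Fin 2) ℂ) * (quatVec (∑ ν ∈ Finset.univ.erase e.2,
            (vecQuat (((V (Site.shift e.1 e.2, ν) * (V (Site.shift e.1 ν, e.2))⁻¹ * (V (e.1, ν))⁻¹)⁻¹ : (Matrix.specialUnitaryGroup (Fin 2) ℂ)) : Matrix (Fin 2) (Fin 2) ℂ) +
              vecQuat ((((V (Site.shift (e.1 - Pi.single ν 1) e.2, ν))⁻¹ * (V (e.1 - Pi.single ν 1, e.2))⁻¹ *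
                V (e.1 - Pi.single ν 1, ν))⁻¹ : (Matrix.specialUnitaryGroup (Fin 2) ℂ)) : Matrix (Fin 2) (Fin 2) ℂ))))ᴴ) :=
    (IsQuat.of_mem_specialUnitaryGroup (V e).2).mul (isQuat_quatVec _).conjTranspose
  have hc : (toLp 2 ![0, (fun q : Edge d L × Fin 3 => κ * vecQuat (((V q.1 : Matrix.specialUnitaryGroup (Fin 2) ℂ) : Matrix (Fin 2) (Fin 2) ℂ) * (quatVec (∑ ν ∈ Finset.univ.erase q.1.2,
            (vecQuat (((V (Site.shift q.1.1 q.1.2, ν) * (V (Site.shift q.1.1 ν, q.1.2))⁻¹ * (V (q.1.1, ν))⁻¹)⁻¹ : (Matrix.specialUnitaryGroup (Fin 2) ℂ)) : Matrix (Fin 2) (Fin 2) ℂ) +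
              vecQuat ((((V (Site.shift (q.1.1 - Pi.single ν 1) q.1.2, ν))⁻¹ * (V (q.1.1 - Pi.single ν 1, q.1.2))⁻¹ *
                V (q.1.1 - Pi.single ν 1, ν))⁻¹ : (Matrix.specialUnitaryGroup (Fin 2) ℂ)) : Matrix (Fin 2) (Fin 2) ℂ))))ᴴ) q.2.succ) (e, 0), (fun q : Edge d L × Fin 3 => κ * vecQuat (((V q.1 : Matrix.specialUnitaryGroup (Fin 2) ℂ) : Matrix (Fin 2) (Fin 2) ℂ) * (quatVec (∑ ν ∈ Finset.univ.erase q.1.2,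
            (vecQuat (((V (Site.shift q.1.1 q.1.2, ν) * (V (Site.shift q.1.1 ν, q.1.2))⁻¹ * (V (q.1.1, ν))⁻¹)⁻¹ : (Matrix.specialUnitaryGroup (Fin 2) ℂ)) : Matrix (Fin 2) (Fin 2) ℂ) +
              vecQuat ((((V (Site.shift (q.1.1 - Pi.single ν 1) q.1.2, ν))⁻¹ * (V (q.1.1 - Pi.single ν 1, q.1.2))⁻¹ *
                V (q.1.1 - Pi.single ν 1, ν))⁻¹ : (Matrix.specialUnitaryGroup (Fin 2) ℂ)) : Matrix (Fin 2) (Fin 2) ℂ))))ᴴ) q.2.succ) (e, 1), (fun q : Edge d L × Fin 3 => κ * vecQuat (((V q.1 : Matrix.specialUnitaryGroup (Fin 2) ℂ) : Matrix (Fin 2) (Fin 2) ℂ) * (quatVec (∑ ν ∈ Finset.univ.erase q.1.2,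
            (vecQuat (((V (Site.shift q.1.1 q.1.2, ν) * (V (Site.shift q.1.1 ν, q.1.2))⁻¹ * (V (q.1.1, ν))⁻¹)⁻¹ : (Matrix.specialUnitaryGroup (Fin 2) ℂ)) : Matrix (Fin 2) (Fin 2) ℂ) +
              vecQuat ((((V (Site.shift (q.1.1 - Pi.single ν 1) q.1.2, ν))⁻¹ * (V (q.1.1 - Pi.single ν 1, q.1.2))⁻¹ *
                V (q.1.1 - Pi.single ν 1, ν))⁻¹ : (Matrix.specialUnitaryGroup (Fin 2) ℂ)) : Matrix (Fin 2) (Fin 2) ℂ))))ᴴ) q.2.succ) (e, 2)] : R4) =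
      κ • toLp 2 ![0, vecQuat (((V e : Matrix.specialUnitaryGroup (Fin 2) ℂ) : Matrix (Fin 2) (Fin 2) ℂ) * (quatVec (∑ ν ∈ Finset.univ.erase e.2,
            (vecQuat (((V (Site.shift e.1 e.2, ν) * (V (Site.shift e.1 ν, e.2))⁻¹ * (V (e.1, ν))⁻¹)⁻¹ : (Matrix.specialUnitaryGroup (Fin 2) ℂ)) : Matrix (Fin 2) (Fin 2) ℂ) +
              vecQuat ((((V (Site.shift (e.1 - Pi.single ν 1) e.2, ν))⁻¹ * (V (e.1 - Pi.single ν 1, e.2))⁻¹ *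
                V (e.1 - Pi.single ν 1, ν))⁻¹ : (Matrix.specialUnitaryGroup (Fin 2) ℂ)) : Matrix (Fin 2) (Fin 2) ℂ))))ᴴ) 1, vecQuat (((V e : Matrix.specialUnitaryGroup (Fin 2) ℂ) : Matrix (Fin 2) (Fin 2) ℂ) * (quatVec (∑ ν ∈ Finset.univ.erase e.2,
            (vecQuat (((V (Site.shift e.1 e.2, ν) * (V (Site.shift e.1 ν, e.2))⁻¹ * (V (e.1, ν))⁻¹)⁻¹ : (Matrix.specialUnitaryGroup (Fin 2) ℂ)) : Matrix (Fin 2) (Fin 2) ℂ) +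
              vecQuat ((((V (Site.shift (e.1 - Pi.single ν 1) e.2, ν))⁻¹ * (V (e.1 - Pi.single ν 1, e.2))⁻¹ *
                V (e.1 - Pi.single ν 1, ν))⁻¹ : (Matrix.specialUnitaryGroup (Fin 2) ℂ)) : Matrix (Fin 2) (Fin 2) ℂ))))ᴴ) 2, vecQuat (((V e : Matrix.specialUnitaryGroup (Fin 2) ℂ) : Matrix (Fin 2) (Fin 2) ℂ) * (quatVec (∑ ν ∈ Finset.univ.erase e.2,
            (vecQuat (((V (Site.shift e.1 e.2, ν) * (V (Site.shift e.1 ν, e.2))⁻¹ * (V (e.1, ν))⁻¹)⁻¹ : (Matrix.specialUnitaryGroup (Fin 2) ℂ)) : Matrix (Fin 2) (Fin 2) ℂ) +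
              vecQuat ((((V (Site.shift (e.1 - Pi.single ν 1) e.2, ν))⁻¹ * (V (e.1 - Pi.single ν 1, e.2))⁻¹ *
                V (e.1 - Pi.single ν 1, ν))⁻¹ : (Matrix.specialUnitaryGroup (Fin 2) ℂ)) : Matrix (Fin 2) (Fin 2) ℂ))))ᴴ) 3] := by
    ext j
    fin_cases j <;> simp
  dsimp only
  rw [hc, su2WilsonForceMatrix_gaugeTransform h V e, vecQuat_conj_succ (h e.1) hq i, quatVec_smul,
    Matrix.mul_smul, Matrix.smul_mul, vecQuat_smul, PiLp.smul_apply, smul_eq_mul]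

/-- The Wilson force routine is measurable (indeed continuous) in the field. -/
theorem measurable_su2WilsonForce [NeZero L] (κ : ℝ) :
    Measurable fun V : GaugeConfig d L (Matrix.specialUnitaryGroup (Fin 2) ℂ) => (fun q : Edge d L × Fin 3 => κ * vecQuat (((V q.1 : Matrix.specialUnitaryGroup (Fin 2) ℂ) : Matrix (Fin 2) (Fin 2) ℂ) * (quatVec (∑ ν ∈ Finset.univ.erase q.1.2,
            (vecQuat (((V (Site.shift q.1.1 q.1.2, ν) * (V (Site.shift q.1.1 ν, q.1.2))⁻¹ * (V (q.1.1, ν))⁻¹)⁻¹ : (Matrix.specialUnitaryGroup (Fin 2) ℂ)) : Matrix (Fin 2) (Fin 2) ℂ) +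
              vecQuat ((((V (Site.shift (q.1.1 - Pi.single ν 1) q.1.2, ν))⁻¹ * (V (q.1.1 - Pi.single ν 1, q.1.2))⁻¹ *
                V (q.1.1 - Pi.single ν 1, ν))⁻¹ : (Matrix.specialUnitaryGroup (Fin 2) ℂ)) : Matrix (Fin 2) (Fin 2) ℂ))))ᴴ) q.2.succ) := by
  refine measurable_pi_lambda _ fun q => ?_
  have hM : Continuous fun V : GaugeConfig d L (Matrix.specialUnitaryGroup (Fin 2) ℂ) => (((V q.1 : Matrix.specialUnitaryGroup (Fin 2) ℂ) : Matrix (Fin 2) (Fin 2) ℂ) * (quatVec (∑ ν ∈ Finset.univ.erase q.1.2,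
            (vecQuat (((V (Site.shift q.1.1 q.1.2, ν) * (V (Site.shift q.1.1 ν, q.1.2))⁻¹ * (V (q.1.1, ν))⁻¹)⁻¹ : (Matrix.specialUnitaryGroup (Fin 2) ℂ)) : Matrix (Fin 2) (Fin 2) ℂ) +
              vecQuat ((((V (Site.shift (q.1.1 - Pi.single ν 1) q.1.2, ν))⁻¹ * (V (q.1.1 - Pi.single ν 1, q.1.2))⁻¹ *
                V (q.1.1 - Pi.single ν 1, ν))⁻¹ : (Matrix.specialUnitaryGroup (Fin 2) ℂ)) : Matrix (Fin 2) (Fin 2) ℂ))))ᴴ) :=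
    (continuous_subtype_val.comp (continuous_apply q.1)).mul
      ((continuous_quatVec.comp (continuous_stapleJ q.1)).matrix_conjTranspose)
  exact (continuous_const.mul ((PiLp.continuous_apply 2 _ q.2.succ).comp (continuous_vecQuat.comp hM))).measurable

end Force

/-! ## HMC with the Wilson force routine commutes with every gauge transformation -/

section Kernel

variable {Q P : Type*} [Group Q] [MeasurableSpace Q] [MeasurableMul₂ Q]
  [AddCommGroup P] [MeasurableSpace P] [MeasurableNeg P] [MeasurableAdd₂ P]

/-- **Member-free form of `gauge_fthmc_conjKernel_eq_self`** (plain gauge-link HMC): if `R` is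
additive, odd and `ν`-preserving, `T ∘ R = T`, the drift and the force are covariant and
`S ∘ Θ = S`, the configuration kernel `refresh; involMH (flip ∘ leapfrog^n) (S + T); forget`
commutes with `Θ`. -/
theorem gauge_hmc_conjKernel_eq_self {ν : Measure P} [SFinite ν] {e : P → Q} (hem : Measurable e)
    {g : Q → P} (hg : Measurable g) (n : ℕ) {S : Q → ℝ} (hS : Measurable S) {T : P → ℝ}
    (hT : Measurable T) (Θ : Q ≃ᵐ Q) (R : P ≃ᵐ P)
    (hRneg : ∀ p, R (-p) = -R p) (hRadd : ∀ p p', R (p + p') = R p + R p')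
    (he : ∀ p q, e (R p) * Θ q = Θ (e p * q)) (hgΘ : ∀ q, g (Θ q) = R (g q))
    (hSΘ : ∀ q, S (Θ q) = S q) (hTR : ∀ p, T (R p) = T p) (hRν : MeasurePreserving R ν ν) :
    conjKernel
      (refreshUpdate
        (involMH (⇑((flip : Equiv.Perm (Q × P)) * leapfrog (mulDrift e) g ^ n))
          (measurable_flip_leapfrog_pow (measurable_mulDrift hem) hg n)
          fun z : Q × P => S z.1 + T z.2)
        ((ν.withDensity (fun q => ENNReal.ofReal (Real.exp (-T q))) Set.univ)⁻¹ •
          ν.withDensity fun q => ENNReal.ofReal (Real.exp (-T q)))) Θ =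
      refreshUpdate
        (involMH (⇑((flip : Equiv.Perm (Q × P)) * leapfrog (mulDrift e) g ^ n))
          (measurable_flip_leapfrog_pow (measurable_mulDrift hem) hg n)
          fun z : Q × P => S z.1 + T z.2)
        ((ν.withDensity (fun q => ENNReal.ofReal (Real.exp (-T q))) Set.univ)⁻¹ •
          ν.withDensity fun q => ENNReal.ofReal (Real.exp (-T q))) := by
  have hH : Measurable fun z : Q × P => S z.1 + T z.2 :=
    (hS.comp measurable_fst).add (hT.comp measurable_snd)
  have hf : Measurable fun q : P => ENNReal.ofReal (Real.exp (-T q)) :=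
    ENNReal.measurable_ofReal.comp (Real.measurable_exp.comp hT.neg)
  have hR : (((ν.withDensity (fun q => ENNReal.ofReal (Real.exp (-T q))) Set.univ)⁻¹ •
      ν.withDensity fun q => ENNReal.ofReal (Real.exp (-T q))).map R) =
      (ν.withDensity (fun q => ENNReal.ofReal (Real.exp (-T q))) Set.univ)⁻¹ •
        ν.withDensity fun q => ENNReal.ofReal (Real.exp (-T q)) := by
    rw [Measure.map_smul, map_withDensity_eq_of_measurePreserving R hRν hf (fun p => by rw [hTR])]
  have hcomm := commute_flip_leapfrog_pow_prodMap (θ := ⇑Θ) (e := e) (g := g) hRneg hRadd he hgΘ n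
  refine conjKernel_refreshUpdate_eq_self _ _ Θ R hR (conjKernel_involMH_of_comm hH _ (fun z => hcomm z) fun z => ?_)
  change S (Θ z.1) + T (R z.2) = S z.1 + T z.2
  rw [hSΘ, hTR]

end Kernel

section SU2

variable {d L : ℕ} [NeZero L]

/-- **`SU(2)` HMC with the Wilson force routine commutes with every gauge transformation — no
hypothesis on the force left.**  Refresh `N(0,1)` momenta on `(Edge × Fin 3) → ℝ`, leapfrog^n with
the quaternion exponential drift `U_ℓ ← exp(c P_ℓ) U_ℓ` and the force routine
`g_κ V (ℓ, i) = κ · vecQuat (U_ℓ (quatVec J_ℓ(V))ᴴ) (i+1)`, flip, Metropolis on `S + Σ p²/2`,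
forget: for every gauge-invariant measurable `S`, every `c`, `κ`, `n` and every `h : Λ → SU(2)`,
`conjKernel K (Θ_h) = K`. -/
theorem su2_hmc_wilsonForce_conjKernel_gaugeTransform (h : Site d L → Matrix.specialUnitaryGroup (Fin 2) ℂ)
    {S : GaugeConfig d L (Matrix.specialUnitaryGroup (Fin 2) ℂ) → ℝ} (hS : Measurable S) (hSi : IsGaugeInvariant S) (c κ : ℝ) (n : ℕ) :
    conjKernel
      (refreshUpdate
        (involMH
          (⇑((flip : Equiv.Perm (GaugeConfig d L (Matrix.specialUnitaryGroup (Fin 2) ℂ) × ((Edge d L × Fin 3) → ℝ))) *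
              leapfrog (mulDrift fun p : ((Edge d L × Fin 3) → ℝ) =>
                fun ℓ : Edge d L => gaussUnit (toLp 2
          ![Real.cos (c * Real.sqrt (p (ℓ, 0) ^ 2 + p (ℓ, 1) ^ 2 + p (ℓ, 2) ^ 2)),
            c * Real.sinc (c * Real.sqrt (p (ℓ, 0) ^ 2 + p (ℓ, 1) ^ 2 + p (ℓ, 2) ^ 2)) * p (ℓ, 0),
            c * Real.sinc (c * Real.sqrt (p (ℓ, 0) ^ 2 + p (ℓ, 1) ^ 2 + p (ℓ, 2) ^ 2)) * p (ℓ, 1),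
            c * Real.sinc (c * Real.sqrt (p (ℓ, 0) ^ 2 + p (ℓ, 1) ^ 2 + p (ℓ, 2) ^ 2)) * p (ℓ, 2)])) (fun V : GaugeConfig d L (Matrix.specialUnitaryGroup (Fin 2) ℂ) => (fun q : Edge d L × Fin 3 => κ * vecQuat (((V q.1 : Matrix.specialUnitaryGroup (Fin 2) ℂ) : Matrix (Fin 2) (Fin 2) ℂ) * (quatVec (∑ ν ∈ Finset.univ.erase q.1.2,
            (vecQuat (((V (Site.shift q.1.1 q.1.2, ν) * (V (Site.shift q.1.1 ν, q.1.2))⁻¹ * (V (q.1.1, ν))⁻¹)⁻¹ : (Matrix.specialUnitaryGroup (Fin 2) ℂ)) : Matrix (Fin 2) (Fin 2) ℂ) +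
              vecQuat ((((V (Site.shift (q.1.1 - Pi.single ν 1) q.1.2, ν))⁻¹ * (V (q.1.1 - Pi.single ν 1, q.1.2))⁻¹ *
                V (q.1.1 - Pi.single ν 1, ν))⁻¹ : (Matrix.specialUnitaryGroup (Fin 2) ℂ)) : Matrix (Fin 2) (Fin 2) ℂ))))ᴴ) q.2.succ)) ^ n))
          (measurable_flip_leapfrog_pow (measurable_mulDrift (measurable_su2Drift c)) (measurable_su2WilsonForce (d := d) (L := L) κ) n)
          fun z : GaugeConfig d L (Matrix.specialUnitaryGroup (Fin 2) ℂ) × ((Edge d L × Fin 3) → ℝ) => S z.1 + ∑ i, z.2 i ^ 2 / 2)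
        ((((volume : Measure ((Edge d L × Fin 3) → ℝ)).withDensity
                  fun p => ENNReal.ofReal (Real.exp (-(∑ i, p i ^ 2 / 2)))) Set.univ)⁻¹ •
              (volume : Measure ((Edge d L × Fin 3) → ℝ)).withDensity
                fun p => ENNReal.ofReal (Real.exp (-(∑ i, p i ^ 2 / 2)))))
      (Elitzur.gaugeTransformMEquiv h) =
      (refreshUpdate
        (involMH
          (⇑((flip : Equiv.Perm (GaugeConfig d L (Matrix.specialUnitaryGroup (Fin 2) ℂ) × ((Edge d L × Fin 3) → ℝ))) *
              leapfrog (mulDrift fun p : ((Edge d L × Fin 3) → ℝ) =>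
                fun ℓ : Edge d L => gaussUnit (toLp 2
          ![Real.cos (c * Real.sqrt (p (ℓ, 0) ^ 2 + p (ℓ, 1) ^ 2 + p (ℓ, 2) ^ 2)),
            c * Real.sinc (c * Real.sqrt (p (ℓ, 0) ^ 2 + p (ℓ, 1) ^ 2 + p (ℓ, 2) ^ 2)) * p (ℓ, 0),
            c * Real.sinc (c * Real.sqrt (p (ℓ, 0) ^ 2 + p (ℓ, 1) ^ 2 + p (ℓ, 2) ^ 2)) * p (ℓ, 1),
            c * Real.sinc (c * Real.sqrt (p (ℓ, 0) ^ 2 + p (ℓ, 1) ^ 2 + p (ℓ, 2) ^ 2)) * p (ℓ, 2)])) (fun V : GaugeConfig d L (Matrix.specialUnitaryGroup (Fin 2) ℂ) => (fun q : Edge d L × Fin 3 => κ * vecQuat (((V q.1 : Matrix.specialUnitaryGroup (Fin 2) ℂ) : Matrix (Fin 2) (Fin 2) ℂ) * (quatVec (∑ ν ∈ Finset.univ.erase q.1.2,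
            (vecQuat (((V (Site.shift q.1.1 q.1.2, ν) * (V (Site.shift q.1.1 ν, q.1.2))⁻¹ * (V (q.1.1, ν))⁻¹)⁻¹ : (Matrix.specialUnitaryGroup (Fin 2) ℂ)) : Matrix (Fin 2) (Fin 2) ℂ) +
              vecQuat ((((V (Site.shift (q.1.1 - Pi.single ν 1) q.1.2, ν))⁻¹ * (V (q.1.1 - Pi.single ν 1, q.1.2))⁻¹ *
                V (q.1.1 - Pi.single ν 1, ν))⁻¹ : (Matrix.specialUnitaryGroup (Fin 2) ℂ)) : Matrix (Fin 2) (Fin 2) ℂ))))ᴴ) q.2.succ)) ^ n))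
          (measurable_flip_leapfrog_pow (measurable_mulDrift (measurable_su2Drift c)) (measurable_su2WilsonForce (d := d) (L := L) κ) n)
          fun z : GaugeConfig d L (Matrix.specialUnitaryGroup (Fin 2) ℂ) × ((Edge d L × Fin 3) → ℝ) => S z.1 + ∑ i, z.2 i ^ 2 / 2)
        ((((volume : Measure ((Edge d L × Fin 3) → ℝ)).withDensity
                  fun p => ENNReal.ofReal (Real.exp (-(∑ i, p i ^ 2 / 2)))) Set.univ)⁻¹ •
              (volume : Measure ((Edge d L × Fin 3) → ℝ)).withDensity
                fun p => ENNReal.ofReal (Real.exp (-(∑ i, p i ^ 2 / 2))))) := by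
  let R : ((Edge d L × Fin 3) → ℝ) ≃ᵐ ((Edge d L × Fin 3) → ℝ) :=
    { toFun := fun p => (fun q : Edge d L × Fin 3 => (vecQuat (((h q.1.1 : Matrix.specialUnitaryGroup (Fin 2) ℂ) : Matrix (Fin 2) (Fin 2) ℂ) * quatVec (toLp 2 ![0, p (q.1, 0), p (q.1, 1), p (q.1, 2)]) * (((h q.1.1 : Matrix.specialUnitaryGroup (Fin 2) ℂ) : Matrix (Fin 2) (Fin 2) ℂ))ᴴ)) q.2.succ)
      invFun := fun p => (fun q : Edge d L × Fin 3 => (vecQuat (((h⁻¹ q.1.1 : Matrix.specialUnitaryGroup (Fin 2) ℂ) : Matrix (Fin 2) (Fin 2) ℂ) * quatVec (toLp 2 ![0, p (q.1, 0), p (q.1, 1), p (q.1, 2)]) * (((h⁻¹ q.1.1 : Matrix.specialUnitaryGroup (Fin 2) ℂ) : Matrix (Fin 2) (Fin 2) ℂ))ᴴ)) q.2.succ)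
      left_inv := fun p => su2MomRot_inv_left h p
      right_inv := fun p => su2MomRot_inv_right h p
      measurable_toFun := measurable_su2MomRot h
      measurable_invFun := measurable_su2MomRot h⁻¹ }
  have hRapply : ∀ p, R p = (fun q : Edge d L × Fin 3 => (vecQuat (((h q.1.1 : Matrix.specialUnitaryGroup (Fin 2) ℂ) : Matrix (Fin 2) (Fin 2) ℂ) * quatVec (toLp 2 ![0, p (q.1, 0), p (q.1, 1), p (q.1, 2)]) * (((h q.1.1 : Matrix.specialUnitaryGroup (Fin 2) ℂ) : Matrix (Fin 2) (Fin 2) ℂ))ᴴ)) q.2.succ) := fun p => rfl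
  have hRneg : ∀ p, R (-p) = -R p := fun p => by
    rw [hRapply, hRapply]
    exact su2MomRot_neg h p
  have hRadd : ∀ p p', R (p + p') = R p + R p' := fun p p' => by
    rw [hRapply, hRapply, hRapply]
    exact su2MomRot_add h p p'
  have he : ∀ (p : ((Edge d L × Fin 3) → ℝ)) (V : GaugeConfig d L (Matrix.specialUnitaryGroup (Fin 2) ℂ)),
      (fun p : ((Edge d L × Fin 3) → ℝ) =>
            fun ℓ : Edge d L => gaussUnit (toLp 2
          ![Real.cos (c * Real.sqrt (p (ℓ, 0) ^ 2 + p (ℓ, 1) ^ 2 + p (ℓ, 2) ^ 2)),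
            c * Real.sinc (c * Real.sqrt (p (ℓ, 0) ^ 2 + p (ℓ, 1) ^ 2 + p (ℓ, 2) ^ 2)) * p (ℓ, 0),
            c * Real.sinc (c * Real.sqrt (p (ℓ, 0) ^ 2 + p (ℓ, 1) ^ 2 + p (ℓ, 2) ^ 2)) * p (ℓ, 1),
            c * Real.sinc (c * Real.sqrt (p (ℓ, 0) ^ 2 + p (ℓ, 1) ^ 2 + p (ℓ, 2) ^ 2)) * p (ℓ, 2)])) (R p) * (Elitzur.gaugeTransformMEquiv h) V =
        (Elitzur.gaugeTransformMEquiv h) ((fun p : ((Edge d L × Fin 3) → ℝ) =>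
            fun ℓ : Edge d L => gaussUnit (toLp 2
          ![Real.cos (c * Real.sqrt (p (ℓ, 0) ^ 2 + p (ℓ, 1) ^ 2 + p (ℓ, 2) ^ 2)),
            c * Real.sinc (c * Real.sqrt (p (ℓ, 0) ^ 2 + p (ℓ, 1) ^ 2 + p (ℓ, 2) ^ 2)) * p (ℓ, 0),
            c * Real.sinc (c * Real.sqrt (p (ℓ, 0) ^ 2 + p (ℓ, 1) ^ 2 + p (ℓ, 2) ^ 2)) * p (ℓ, 1),
            c * Real.sinc (c * Real.sqrt (p (ℓ, 0) ^ 2 + p (ℓ, 1) ^ 2 + p (ℓ, 2) ^ 2)) * p (ℓ, 2)])) p * V) := fun p V => by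
    rw [hRapply]
    exact su2Drift_su2MomRot_mul_gaugeTransform h c p V
  have hgΘ : ∀ V : GaugeConfig d L (Matrix.specialUnitaryGroup (Fin 2) ℂ), (fun V : GaugeConfig d L (Matrix.specialUnitaryGroup (Fin 2) ℂ) => (fun q : Edge d L × Fin 3 => κ * vecQuat (((V q.1 : Matrix.specialUnitaryGroup (Fin 2) ℂ) : Matrix (Fin 2) (Fin 2) ℂ) * (quatVec (∑ ν ∈ Finset.univ.erase q.1.2,
            (vecQuat (((V (Site.shift q.1.1 q.1.2, ν) * (V (Site.shift q.1.1 ν, q.1.2))⁻¹ * (V (q.1.1, ν))⁻¹)⁻¹ : (Matrix.specialUnitaryGroup (Fin 2) ℂ)) : Matrix (Fin 2) (Fin 2) ℂ) +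
              vecQuat ((((V (Site.shift (q.1.1 - Pi.single ν 1) q.1.2, ν))⁻¹ * (V (q.1.1 - Pi.single ν 1, q.1.2))⁻¹ *
                V (q.1.1 - Pi.single ν 1, ν))⁻¹ : (Matrix.specialUnitaryGroup (Fin 2) ℂ)) : Matrix (Fin 2) (Fin 2) ℂ))))ᴴ) q.2.succ)) ((Elitzur.gaugeTransformMEquiv h) V) =
      R ((fun V : GaugeConfig d L (Matrix.specialUnitaryGroup (Fin 2) ℂ) => (fun q : Edge d L × Fin 3 => κ * vecQuat (((V q.1 : Matrix.specialUnitaryGroup (Fin 2) ℂ) : Matrix (Fin 2) (Fin 2) ℂ) * (quatVec (∑ ν ∈ Finset.univ.erase q.1.2,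
            (vecQuat (((V (Site.shift q.1.1 q.1.2, ν) * (V (Site.shift q.1.1 ν, q.1.2))⁻¹ * (V (q.1.1, ν))⁻¹)⁻¹ : (Matrix.specialUnitaryGroup (Fin 2) ℂ)) : Matrix (Fin 2) (Fin 2) ℂ) +
              vecQuat ((((V (Site.shift (q.1.1 - Pi.single ν 1) q.1.2, ν))⁻¹ * (V (q.1.1 - Pi.single ν 1, q.1.2))⁻¹ *
                V (q.1.1 - Pi.single ν 1, ν))⁻¹ : (Matrix.specialUnitaryGroup (Fin 2) ℂ)) : Matrix (Fin 2) (Fin 2) ℂ))))ᴴ) q.2.succ)) V) := fun V => by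
    rw [hRapply]
    exact su2WilsonForce_gaugeTransform κ h V
  have hSΘ : ∀ V : GaugeConfig d L (Matrix.specialUnitaryGroup (Fin 2) ℂ), S ((Elitzur.gaugeTransformMEquiv h) V) = S V := fun V => hSi h V
  have hTR : ∀ p : ((Edge d L × Fin 3) → ℝ), (fun p : ((Edge d L × Fin 3) → ℝ) => ∑ i, p i ^ 2 / 2) (R p) = (fun p : ((Edge d L × Fin 3) → ℝ) => ∑ i, p i ^ 2 / 2) p := by
    intro p
    change ∑ i, (R p) i ^ 2 / 2 = ∑ i, p i ^ 2 / 2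
    rw [← Finset.sum_div, ← Finset.sum_div, hRapply, sum_sq_su2MomRot]
  have hRν : MeasurePreserving R (volume : Measure ((Edge d L × Fin 3) → ℝ)) volume := measurePreserving_su2MomRot h
  exact gauge_hmc_conjKernel_eq_self (Q := GaugeConfig d L (Matrix.specialUnitaryGroup (Fin 2) ℂ)) (P := ((Edge d L × Fin 3) → ℝ)) (ν := (volume : Measure ((Edge d L × Fin 3) → ℝ)))
    (e := fun p : ((Edge d L × Fin 3) → ℝ) =>
            fun ℓ : Edge d L => gaussUnit (toLp 2
          ![Real.cos (c * Real.sqrt (p (ℓ, 0) ^ 2 + p (ℓ, 1) ^ 2 + p (ℓ, 2) ^ 2)),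
            c * Real.sinc (c * Real.sqrt (p (ℓ, 0) ^ 2 + p (ℓ, 1) ^ 2 + p (ℓ, 2) ^ 2)) * p (ℓ, 0),
            c * Real.sinc (c * Real.sqrt (p (ℓ, 0) ^ 2 + p (ℓ, 1) ^ 2 + p (ℓ, 2) ^ 2)) * p (ℓ, 1),
            c * Real.sinc (c * Real.sqrt (p (ℓ, 0) ^ 2 + p (ℓ, 1) ^ 2 + p (ℓ, 2) ^ 2)) * p (ℓ, 2)]))
    (g := fun V : GaugeConfig d L (Matrix.specialUnitaryGroup (Fin 2) ℂ) => (fun q : Edge d L × Fin 3 => κ * vecQuat (((V q.1 : Matrix.specialUnitaryGroup (Fin 2) ℂ) : Matrix (Fin 2) (Fin 2) ℂ) * (quatVec (∑ ν ∈ Finset.univ.erase q.1.2,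
            (vecQuat (((V (Site.shift q.1.1 q.1.2, ν) * (V (Site.shift q.1.1 ν, q.1.2))⁻¹ * (V (q.1.1, ν))⁻¹)⁻¹ : (Matrix.specialUnitaryGroup (Fin 2) ℂ)) : Matrix (Fin 2) (Fin 2) ℂ) +
              vecQuat ((((V (Site.shift (q.1.1 - Pi.single ν 1) q.1.2, ν))⁻¹ * (V (q.1.1 - Pi.single ν 1, q.1.2))⁻¹ *
                V (q.1.1 - Pi.single ν 1, ν))⁻¹ : (Matrix.specialUnitaryGroup (Fin 2) ℂ)) : Matrix (Fin 2) (Fin 2) ℂ))))ᴴ) q.2.succ)) (S := S) (T := fun p : ((Edge d L × Fin 3) → ℝ) => ∑ i, p i ^ 2 / 2)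
    (measurable_su2Drift c) (measurable_su2WilsonForce (d := d) (L := L) κ) n hS measurable_piGaussianKinetic
    (Elitzur.gaugeTransformMEquiv h) R hRneg hRadd he hgΘ hSΘ hTR hRν

/-- **… and the FT-HMC kernel of `su2_fthmc_conjKernel_gaugeTransform` driven by the Wilson force
routine `g_κ`** (any gauge-equivariant member `F` with invariant measurable booked density `J`,
invariant measurable `S`): the force hypothesis is discharged. -/
theorem su2_fthmc_wilsonForce_conjKernel_gaugeTransform (h : Site d L → Matrix.specialUnitaryGroup (Fin 2) ℂ)
    (F : GaugeConfig d L (Matrix.specialUnitaryGroup (Fin 2) ℂ) ≃ᵐ GaugeConfig d L (Matrix.specialUnitaryGroup (Fin 2) ℂ)) (hF : IsGaugeEquivariant (⇑F))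
    {J : GaugeConfig d L (Matrix.specialUnitaryGroup (Fin 2) ℂ) → ℝ} (hJm : Measurable J) (hJ : IsGaugeInvariant J)
    {S : GaugeConfig d L (Matrix.specialUnitaryGroup (Fin 2) ℂ) → ℝ} (hS : Measurable S) (hSi : IsGaugeInvariant S) (c κ : ℝ) (n : ℕ) :
    conjKernel
      (conjKernel
        (refreshUpdate
          (involMH
            (⇑((flip : Equiv.Perm (GaugeConfig d L (Matrix.specialUnitaryGroup (Fin 2) ℂ) × ((Edge d L × Fin 3) → ℝ))) *
                leapfrog (mulDrift fun p : ((Edge d L × Fin 3) → ℝ) =>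
                  fun ℓ : Edge d L => gaussUnit (toLp 2
          ![Real.cos (c * Real.sqrt (p (ℓ, 0) ^ 2 + p (ℓ, 1) ^ 2 + p (ℓ, 2) ^ 2)),
            c * Real.sinc (c * Real.sqrt (p (ℓ, 0) ^ 2 + p (ℓ, 1) ^ 2 + p (ℓ, 2) ^ 2)) * p (ℓ, 0),
            c * Real.sinc (c * Real.sqrt (p (ℓ, 0) ^ 2 + p (ℓ, 1) ^ 2 + p (ℓ, 2) ^ 2)) * p (ℓ, 1),
            c * Real.sinc (c * Real.sqrt (p (ℓ, 0) ^ 2 + p (ℓ, 1) ^ 2 + p (ℓ, 2) ^ 2)) * p (ℓ, 2)])) (fun V : GaugeConfig d L (Matrix.specialUnitaryGroup (Fin 2) ℂ) => (fun q : Edge d L × Fin 3 => κ * vecQuat (((V q.1 : Matrix.specialUnitaryGroup (Fin 2) ℂ) : Matrix (Fin 2) (Fin 2) ℂ) * (quatVec (∑ ν ∈ Finset.univ.erase q.1.2,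
            (vecQuat (((V (Site.shift q.1.1 q.1.2, ν) * (V (Site.shift q.1.1 ν, q.1.2))⁻¹ * (V (q.1.1, ν))⁻¹)⁻¹ : (Matrix.specialUnitaryGroup (Fin 2) ℂ)) : Matrix (Fin 2) (Fin 2) ℂ) +
              vecQuat ((((V (Site.shift (q.1.1 - Pi.single ν 1) q.1.2, ν))⁻¹ * (V (q.1.1 - Pi.single ν 1, q.1.2))⁻¹ *
                V (q.1.1 - Pi.single ν 1, ν))⁻¹ : (Matrix.specialUnitaryGroup (Fin 2) ℂ)) : Matrix (Fin 2) (Fin 2) ℂ))))ᴴ) q.2.succ)) ^ n))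
            (measurable_flip_leapfrog_pow (measurable_mulDrift (measurable_su2Drift c)) (measurable_su2WilsonForce (d := d) (L := L) κ) n)
            fun z : GaugeConfig d L (Matrix.specialUnitaryGroup (Fin 2) ℂ) × ((Edge d L × Fin 3) → ℝ) =>
              (S (F z.1) - Real.log (J z.1)) + ∑ i, z.2 i ^ 2 / 2)
          ((((volume : Measure ((Edge d L × Fin 3) → ℝ)).withDensity
                  fun p => ENNReal.ofReal (Real.exp (-(∑ i, p i ^ 2 / 2)))) Set.univ)⁻¹ •
              (volume : Measure ((Edge d L × Fin 3) → ℝ)).withDensity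
                fun p => ENNReal.ofReal (Real.exp (-(∑ i, p i ^ 2 / 2)))))
        F)
      (Elitzur.gaugeTransformMEquiv h) =
      (conjKernel
        (refreshUpdate
          (involMH
            (⇑((flip : Equiv.Perm (GaugeConfig d L (Matrix.specialUnitaryGroup (Fin 2) ℂ) × ((Edge d L × Fin 3) → ℝ))) *
                leapfrog (mulDrift fun p : ((Edge d L × Fin 3) → ℝ) =>
                  fun ℓ : Edge d L => gaussUnit (toLp 2
          ![Real.cos (c * Real.sqrt (p (ℓ, 0) ^ 2 + p (ℓ, 1) ^ 2 + p (ℓ, 2) ^ 2)),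
            c * Real.sinc (c * Real.sqrt (p (ℓ, 0) ^ 2 + p (ℓ, 1) ^ 2 + p (ℓ, 2) ^ 2)) * p (ℓ, 0),
            c * Real.sinc (c * Real.sqrt (p (ℓ, 0) ^ 2 + p (ℓ, 1) ^ 2 + p (ℓ, 2) ^ 2)) * p (ℓ, 1),
            c * Real.sinc (c * Real.sqrt (p (ℓ, 0) ^ 2 + p (ℓ, 1) ^ 2 + p (ℓ, 2) ^ 2)) * p (ℓ, 2)])) (fun V : GaugeConfig d L (Matrix.specialUnitaryGroup (Fin 2) ℂ) => (fun q : Edge d L × Fin 3 => κ * vecQuat (((V q.1 : Matrix.specialUnitaryGroup (Fin 2) ℂ) : Matrix (Fin 2) (Fin 2) ℂ) * (quatVec (∑ ν ∈ Finset.univ.erase q.1.2,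
            (vecQuat (((V (Site.shift q.1.1 q.1.2, ν) * (V (Site.shift q.1.1 ν, q.1.2))⁻¹ * (V (q.1.1, ν))⁻¹)⁻¹ : (Matrix.specialUnitaryGroup (Fin 2) ℂ)) : Matrix (Fin 2) (Fin 2) ℂ) +
              vecQuat ((((V (Site.shift (q.1.1 - Pi.single ν 1) q.1.2, ν))⁻¹ * (V (q.1.1 - Pi.single ν 1, q.1.2))⁻¹ *
                V (q.1.1 - Pi.single ν 1, ν))⁻¹ : (Matrix.specialUnitaryGroup (Fin 2) ℂ)) : Matrix (Fin 2) (Fin 2) ℂ))))ᴴ) q.2.succ)) ^ n))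
            (measurable_flip_leapfrog_pow (measurable_mulDrift (measurable_su2Drift c)) (measurable_su2WilsonForce (d := d) (L := L) κ) n)
            fun z : GaugeConfig d L (Matrix.specialUnitaryGroup (Fin 2) ℂ) × ((Edge d L × Fin 3) → ℝ) =>
              (S (F z.1) - Real.log (J z.1)) + ∑ i, z.2 i ^ 2 / 2)
          ((((volume : Measure ((Edge d L × Fin 3) → ℝ)).withDensity
                  fun p => ENNReal.ofReal (Real.exp (-(∑ i, p i ^ 2 / 2)))) Set.univ)⁻¹ •
              (volume : Measure ((Edge d L × Fin 3) → ℝ)).withDensity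
                fun p => ENNReal.ofReal (Real.exp (-(∑ i, p i ^ 2 / 2)))))
        F) :=
  su2_fthmc_conjKernel_gaugeTransform h F hF hJm hJ hS hSi c (measurable_su2WilsonForce (d := d) (L := L) κ)
    (fun V => su2WilsonForce_gaugeTransform κ h V) n

end SU2

end Summit.Ventures.LatticeQCDFlow.Exactness
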